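import Mathlib
import HarnessLib
import Summits.Ventures.LatticeQCDFlow.Exactness.MomentumRefresh
import Summits.Ventures.LatticeQCDFlow.Exactness.PiGroupKicks
import Summits.Ventures.LatticeQCDFlow.Exactness.MetropolisSweepConvergence
import Summits.Ventures.LatticeQCDFlow.Exactness.DoeblinUniqueness

/-!
# `tau_jitter`: an HMC update whose integrator is drawn at random, independently of the state, is exact — and inherits the Doeblin power of any atom of the jitter law

HONEST FRAMING: exact (Metropolis-corrected) sampling algorithms for lattice gauge theory;
figures of merit are autocorrelation/cost numbers at stated couplings and volumes; no
continuum-physics claim.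

Venture `LatticeQCDFlow` (cell pub-lqcd), topic `Exactness`, FANOUT row 9 (eng-latcore, the engine's
`latflow.core.hmc.HMC.trajectory(rng, τ, nstep, tau_jitter = j)` / `phi4_2d.hmc(..., tau_jitter = j)`:
the trajectory length is drawn as `τ(1 + j(2u − 1))`, `u ∼ U(0,1)` drawn BEFORE and INDEPENDENTLY of the
configuration, then the leapfrog update of that length is run).  NEW WORK of the cell over the tree
(`MomentumRefresh.lean`: `refreshUpdate`, `refreshUpdate_apply'`, `hmc_config_exact`;
`InvolutiveMetropolis.lean`: `involMH`, `involMH_apply`; `PiGroupKicks.smul_nHit_le_nHit`;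
`MetropolisSweepConvergence.uniformlyErgodic_of_nHit_minorised`; `DoeblinUniqueness.invariant_unique_of_minorised`)
and Mathlib (`MeasurePreserving.skew_product`, `measurePreserving_prodAssoc`, `lintegral_prod_symm`).
Nothing is cited as a fact; no number is claimed.  Printed counterpart, NAMED ONLY: Mackenzie 1989
(randomised trajectory lengths against the resonances of fixed-length HMC).  The finite-state clause
"a mixture of exact kernels is exact" is `KernelMixture.lean`; THIS file is the general-state-space
statement the engine actually uses (`SU(N)^links`, `ℝ^V`), obtained WITHOUT any mixture bookkeeping:

THE DEVICE.  The label `e` (which integrator / which step size) is made part of the MOMENTUM: the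
auxiliary variable is `(π, e) ∼ μP ⊗ η`, the proposal is the single involution
`jitterMap Φ (u, (π, e)) = ((Φ_e (u, π)).1, ((Φ_e (u, π)).2, e))` of the enlarged phase space
`Ω × (P × E)`, and the Hamiltonian `S(u) + T(π)` ignores `e`.  Then the jittered update IS an ordinary
HMC update (`refreshUpdate (involMH …) (μP ⊗ η)`) and the tree's `hmc_config_exact` applies verbatim.

* §1 `jitterMap`; `jitterMap_involutive` (each `Φ_e` an involution), `measurable_jitterMap` (joint
  measurability), `measurable_jitterMap_of_countable` (countably many labels: slice-wise measurability
  suffices — every floating-point jitter law), `measurable_of_jitterMap`, `measurePreserving_jitterMap`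
  (each `Φ_e` preserves `vol ⊗ volP` ⇒ `jitterMap Φ` preserves `vol ⊗ (volP ⊗ η)`, any s-finite `η`).
* §2 **`jitterHMC Φ hΦ S T η μP : Kernel Ω Ω`** — refresh `(π, e) ∼ μP ⊗ η`, propose `Φ_e`, Metropolis test
  on `S + T`, forget `(π, e)`; **`jitterHMC_apply`** — it IS the `η`-mixture of the frozen-label updates:
  `K_jit(u, A) = ∫ K_e(u, A) η(de)`, `K_e = refreshUpdate (involMH Φ_e · (S + T)) μP`.
* §3 **`jitterHMC_exact`** — for EVERY probability law `η` on the labels: if every `Φ_e` is a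
  `vol ⊗ volP`-preserving involution (jointly measurable) and `0 < Z_T < ∞`, the jittered update with the
  Gaussian-type refresh `Z_T⁻¹e^{−T}·volP` leaves `e^{−S}·vol` invariant.  No smallness, no countability.
* §4 **`smul_frozen_le_jitterHMC`** — `η{e₀} · K_{e₀}(u, ·) ≤ K_jit(u, ·)`: the jittered update dominates
  each ATOM's update; **`jitterHMC_nHit_minorised_of_atom`** — hence a Doeblin power of `K_{e₀}`
  (`a · ν ≤ K_{e₀}^{k+1}(u, ·)` for all `u`) gives `(η{e₀}^{k+1} a) · ν ≤ K_jit^{k+1}(u, ·)` for all `u`;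
  **`jitterHMC_uniformlyErgodic_of_atom`** — so the jittered chain converges from EVERY initial law at
  every time, `|μ₀ K_jitᵗ(A) − π(A)| ≤ (1 − δ)^{⌊t/(k+1)⌋}`, and `π` is its unique invariant probability law.

Reading for the engine (value-free): `tau_jitter` is exact for EVERY jitter law — continuous or
floating-point — because it is HMC with the enlarged momentum `(π, u)`; and whenever the jitter law has
an atom whose trajectory length lies in a regime where the fixed-length update has a Doeblin power (the
tree's short-trajectory theorems), the jittered chain is uniformly ergodic.  The engine's `u` is a 53-bit
uniform, i.e. a law with `2^53` atoms, so this covers the code as run whenever `τ(1 − j)` is below the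
short-trajectory threshold (instance: `SUNJitteredLeapfrogHMC.lean`).  NOT CLAIMED: ergodicity for an
ATOMLESS jitter law (products of updates with DIFFERENT step sizes would need constants uniform in the
step — not in the tree); that jitter CURES anything (it does not repair a missing minorant; resonances:
row 2's `FreeFieldHMCResonance.lean` / `RandomisedHMC.lean` on `ℝ^V`); any rate; floating point.
-/

noncomputable section

namespace Summit.Ventures.LatticeQCDFlow.Exactness

open MeasureTheory ProbabilityTheory ProbabilityTheory.Kernel Set Function
open scoped ENNReal

variable {Ω P E : Type*}

/-! ## §1 The labelled proposal on the enlarged phase space `Ω × (P × E)` -/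

section JitterMap

variable (Φ : E → Ω × P → Ω × P)

/-- **The jittered proposal.**  The label `e` rides along with the momentum and selects the phase-space
map applied: `(u, (π, e)) ↦ ((Φ_e (u, π)).1, ((Φ_e (u, π)).2, e))`. -/
def jitterMap (z : Ω × (P × E)) : Ω × (P × E) :=
  ((Φ z.2.2 (z.1, z.2.1)).1, ((Φ z.2.2 (z.1, z.2.1)).2, z.2.2))

/-- The configuration proposed is the one `Φ_e` proposes. -/
@[simp] theorem jitterMap_fst (z : Ω × (P × E)) : (jitterMap Φ z).1 = (Φ z.2.2 (z.1, z.2.1)).1 := rfl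

/-- The momentum proposed is the one `Φ_e` proposes. -/
@[simp] theorem jitterMap_snd_fst (z : Ω × (P × E)) : (jitterMap Φ z).2.1 = (Φ z.2.2 (z.1, z.2.1)).2 := rfl

/-- The label is carried along unchanged. -/
@[simp] theorem jitterMap_snd_snd (z : Ω × (P × E)) : (jitterMap Φ z).2.2 = z.2.2 := rfl

variable {Φ}

/-- Each `Φ_e` an involution ⇒ the jittered proposal is an involution. -/
theorem jitterMap_involutive (hΦ : ∀ e, Involutive (Φ e)) : Involutive (jitterMap Φ) := by
  rintro ⟨u, π, e⟩
  simp only [jitterMap, Prod.mk.eta, hΦ e (u, π)]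

variable [MeasurableSpace Ω] [MeasurableSpace P] [MeasurableSpace E]

/-- Joint measurability of `(e, z) ↦ Φ_e z` ⇒ the jittered proposal is measurable. -/
theorem measurable_jitterMap (hΦm : Measurable fun q : E × (Ω × P) => Φ q.1 q.2) :
    Measurable (jitterMap Φ) := by
  have h : Measurable fun z : Ω × (P × E) => Φ z.2.2 (z.1, z.2.1) :=
    hΦm.comp (measurable_snd.snd.prodMk (measurable_fst.prodMk measurable_snd.fst))
  exact h.fst.prodMk (h.snd.prodMk measurable_snd.snd)

/-- With countably many labels (singletons measurable — every floating-point jitter law) slice-wise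
measurability suffices. -/
theorem measurable_jitterMap_of_countable [Countable E] [MeasurableSingletonClass E]
    (hΦ : ∀ e, Measurable (Φ e)) : Measurable (jitterMap Φ) :=
  measurable_jitterMap (measurable_from_prod_countable_right fun e => hΦ e)

/-- `(e, z) ↦ Φ_e z` is jointly measurable when the jittered proposal is. -/
theorem measurable_uncurry_of_jitterMap (hΦ : Measurable (jitterMap Φ)) :
    Measurable fun q : E × (Ω × P) => Φ q.1 q.2 := by
  have h : Measurable fun q : E × (Ω × P) => jitterMap Φ (q.2.1, (q.2.2, q.1)) :=
    hΦ.comp (measurable_snd.fst.prodMk (measurable_snd.snd.prodMk measurable_fst))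
  have h1 : (fun q : E × (Ω × P) =>
      ((jitterMap Φ (q.2.1, (q.2.2, q.1))).1, (jitterMap Φ (q.2.1, (q.2.2, q.1))).2.1)) =
        fun q => Φ q.1 q.2 := by
    funext q; simp only [jitterMap, Prod.mk.eta]
  rw [← h1]
  exact h.fst.prodMk h.snd.fst

/-- The slices of a measurable jittered proposal are measurable phase-space maps. -/
theorem measurable_of_jitterMap (hΦ : Measurable (jitterMap Φ)) (e : E) : Measurable (Φ e) :=
  (measurable_uncurry_of_jitterMap hΦ).comp (measurable_const.prodMk measurable_id)

/-- **The jittered proposal preserves `vol ⊗ (volP ⊗ η)`** for every s-finite label law `η`, when every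
`Φ_e` preserves `vol ⊗ volP` (a skew product over the label, conjugated by `(u, (π, e)) ↦ (e, (u, π))`). -/
theorem measurePreserving_jitterMap {vol : Measure Ω} {volP : Measure P} {η : Measure E} [SFinite vol]
    [SFinite volP] [SFinite η] (hΦ : Measurable (jitterMap Φ))
    (hvol : ∀ e, MeasurePreserving (Φ e) (vol.prod volP) (vol.prod volP)) :
    MeasurePreserving (jitterMap Φ) (vol.prod (volP.prod η)) (vol.prod (volP.prod η)) := by
  have hJ : MeasurePreserving (fun q : E × (Ω × P) => (q.1, Φ q.1 q.2)) (η.prod (vol.prod volP))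
      (η.prod (vol.prod volP)) :=
    (MeasurePreserving.id η).skew_product (measurable_uncurry_of_jitterMap hΦ)
      (ae_of_all _ fun e => (hvol e).map_eq)
  have hρ : MeasurePreserving (fun z : Ω × (P × E) => (z.2.2, (z.1, z.2.1))) (vol.prod (volP.prod η))
      (η.prod (vol.prod volP)) :=
    (Measure.measurePreserving_swap (μ := vol.prod volP) (ν := η)).comp
      ((measurePreserving_prodAssoc vol volP η).symm _)
  have hρ' : MeasurePreserving (fun q : E × (Ω × P) => (q.2.1, (q.2.2, q.1))) (η.prod (vol.prod volP))
      (vol.prod (volP.prod η)) :=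
    (measurePreserving_prodAssoc vol volP η).comp
      (Measure.measurePreserving_swap (μ := η) (ν := vol.prod volP))
  have hcomp : jitterMap Φ = (fun q : E × (Ω × P) => (q.2.1, (q.2.2, q.1))) ∘
      (fun q : E × (Ω × P) => (q.1, Φ q.1 q.2)) ∘ fun z : Ω × (P × E) => (z.2.2, (z.1, z.2.1)) := by
    funext z; rfl
  rw [hcomp]
  exact hρ'.comp (hJ.comp hρ)

end JitterMap

variable [MeasurableSpace Ω] [MeasurableSpace P] [MeasurableSpace E]

/-! ## §2 The jittered update and its reading as a mixture -/

section Kernel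

variable (Φ : E → Ω × P → Ω × P) (hΦ : Measurable (jitterMap Φ)) (S : Ω → ℝ) (T : P → ℝ)
  (η : Measure E) (μP : Measure P)

/-- **THE JITTERED UPDATE** (`tau_jitter`): refresh the momentum `π ∼ μP` AND an independent label
`e ∼ η`, propose `Φ_e`, accept with `min(1, e^{−ΔH})` for `H = S + T`, forget `(π, e)`. -/
def jitterHMC : Kernel Ω Ω :=
  refreshUpdate (involMH (jitterMap Φ) hΦ fun z : Ω × (P × E) => S z.1 + T z.2.1) (μP.prod η)

variable {S T}

/-- The jittered update is a Markov kernel (probability laws `η`, `μP`; measurable `S`, `T`). -/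
theorem isMarkovKernel_jitterHMC [IsProbabilityMeasure η] [IsProbabilityMeasure μP] (hS : Measurable S)
    (hT : Measurable T) : IsMarkovKernel (jitterHMC Φ hΦ S T η μP) := by
  haveI : Fact (Measurable fun z : Ω × (P × E) => S z.1 + T z.2.1) :=
    ⟨(hS.comp measurable_fst).add (hT.comp measurable_snd.fst)⟩
  unfold jitterHMC
  infer_instance

/-- **THE JITTERED UPDATE IS THE `η`-MIXTURE OF THE FROZEN-LABEL UPDATES**:
`K_jit(u, A) = ∫ K_e(u, A) η(de)`, `K_e = refreshUpdate (involMH Φ_e · (S + T)) μP` (the HMC update whose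
integrator is frozen at label `e`). -/
theorem jitterHMC_apply [SFinite η] [SFinite μP] (hS : Measurable S) (hT : Measurable T) (u : Ω)
    {A : Set Ω} (hA : MeasurableSet A) :
    jitterHMC Φ hΦ S T η μP u A =
      ∫⁻ e, refreshUpdate (involMH (Φ e) (measurable_of_jitterMap hΦ e) fun z : Ω × P => S z.1 + T z.2)
        μP u A ∂η := by
  have hH : Measurable fun z : Ω × P => S z.1 + T z.2 := (hS.comp measurable_fst).add (hT.comp measurable_snd)
  have hH' : Measurable fun z : Ω × (P × E) => S z.1 + T z.2.1 :=
    (hS.comp measurable_fst).add (hT.comp measurable_snd.fst)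
  -- on cylinders `fst⁻¹ A` the labelled kernel at `(u, (π, e))` is the frozen-label kernel at `(u, π)`
  have hpt : ∀ (π : P) (e : E),
      involMH (jitterMap Φ) hΦ (fun z : Ω × (P × E) => S z.1 + T z.2.1) (u, (π, e)) (Prod.fst ⁻¹' A) =
        involMH (Φ e) (measurable_of_jitterMap hΦ e) (fun z : Ω × P => S z.1 + T z.2) (u, π)
          (Prod.fst ⁻¹' A) := by
    intro π e
    rw [involMH_apply hH' _ (measurable_fst hA), involMH_apply hH _ (measurable_fst hA)]
    have ha : involAcceptE (fun z : Ω × (P × E) => S z.1 + T z.2.1) (jitterMap Φ) (u, (π, e)) =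
        involAcceptE (fun z : Ω × P => S z.1 + T z.2) (Φ e) (u, π) := rfl
    have h1 : (Prod.fst ⁻¹' A : Set (Ω × (P × E))).indicator (1 : Ω × (P × E) → ℝ≥0∞)
        (jitterMap Φ (u, (π, e))) = (Prod.fst ⁻¹' A : Set (Ω × P)).indicator 1 (Φ e (u, π)) := by
      by_cases hm : (Φ e (u, π)).1 ∈ A
      · rw [indicator_of_mem (show jitterMap Φ (u, (π, e)) ∈ Prod.fst ⁻¹' A from hm),
          indicator_of_mem (show Φ e (u, π) ∈ Prod.fst ⁻¹' A from hm), Pi.one_apply, Pi.one_apply]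
      · rw [indicator_of_notMem (show jitterMap Φ (u, (π, e)) ∉ Prod.fst ⁻¹' A from hm),
          indicator_of_notMem (show Φ e (u, π) ∉ Prod.fst ⁻¹' A from hm)]
    have h2 : (Prod.fst ⁻¹' A : Set (Ω × (P × E))).indicator (1 : Ω × (P × E) → ℝ≥0∞) (u, (π, e)) =
        (Prod.fst ⁻¹' A : Set (Ω × P)).indicator 1 (u, π) := by
      by_cases hm : u ∈ A
      · rw [indicator_of_mem (show ((u, (π, e)) : Ω × (P × E)) ∈ Prod.fst ⁻¹' A from hm),
          indicator_of_mem (show ((u, π) : Ω × P) ∈ Prod.fst ⁻¹' A from hm), Pi.one_apply, Pi.one_apply]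
      · rw [indicator_of_notMem (show ((u, (π, e)) : Ω × (P × E)) ∉ Prod.fst ⁻¹' A from hm),
          indicator_of_notMem (show ((u, π) : Ω × P) ∉ Prod.fst ⁻¹' A from hm)]
    rw [ha, h1, h2]
  have hF : Measurable fun q : P × E =>
      involMH (jitterMap Φ) hΦ (fun z : Ω × (P × E) => S z.1 + T z.2.1) (u, q) (Prod.fst ⁻¹' A) :=
    (Kernel.measurable_coe _ (measurable_fst hA)).comp measurable_prodMk_left
  rw [jitterHMC, refreshUpdate_apply' _ _ u hA, lintegral_prod_symm _ hF.aemeasurable]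
  refine lintegral_congr fun e => ?_
  rw [refreshUpdate_apply' _ _ u hA]
  exact lintegral_congr fun π => hpt π e

end Kernel

/-! ## §3 Exactness: for EVERY jitter law -/

section Exact

variable {Φ : E → Ω × P → Ω × P} {hΦ : Measurable (jitterMap Φ)} {S : Ω → ℝ} {T : P → ℝ}
  {vol : Measure Ω} {volP : Measure P} [SFinite vol] [SFinite volP]

/-- **`tau_jitter` IS EXACT, FOR EVERY JITTER LAW.**  Target `e^{−S}·vol`; kinetic term `T` with
`0 < Z_T = ∫ e^{−T} dvolP < ∞`, momentum law `μP = Z_T⁻¹e^{−T}·volP`; a family `Φ_e` of measurable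
`vol ⊗ volP`-preserving involutions of phase space (MD integrators of any step sizes / step numbers /
splitting words, then the momentum flip), jointly measurable; `η` ANY probability law on the labels.  Then
"refresh `π ∼ μP` and `e ∼ η` independently of the state → propose `Φ_e` → accept with `min(1, e^{−ΔH})`
→ forget" leaves `e^{−S}·vol` invariant.  (It is `hmc_config_exact` for the enlarged momentum `(π, e)`.) -/
theorem jitterHMC_exact (η : Measure E) [IsProbabilityMeasure η] (hS : Measurable S) (hT : Measurable T)
    (hinv : ∀ e, Involutive (Φ e)) (hvol : ∀ e, MeasurePreserving (Φ e) (vol.prod volP) (vol.prod volP))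
    (hZ0 : volP.withDensity (fun π => ENNReal.ofReal (Real.exp (-T π))) univ ≠ 0)
    (hZtop : volP.withDensity (fun π => ENNReal.ofReal (Real.exp (-T π))) univ ≠ ⊤) :
    Invariant
      (jitterHMC Φ hΦ S T η
        ((volP.withDensity (fun π => ENNReal.ofReal (Real.exp (-T π))) univ)⁻¹ •
          volP.withDensity fun π => ENNReal.ofReal (Real.exp (-T π))))
      (vol.withDensity fun u => ENNReal.ofReal (Real.exp (-S u))) := by
  set νT := volP.withDensity fun π => ENNReal.ofReal (Real.exp (-T π)) with hνT
  have hTm : Measurable fun π => ENNReal.ofReal (Real.exp (-T π)) :=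
    (Real.measurable_exp.comp hT.neg).ennreal_ofReal
  -- the enlarged momentum `(π, e)` with kinetic term `T' (π, e) = T π`
  have hT' : Measurable fun q : P × E => T q.1 := hT.comp measurable_fst
  have hνT' : (volP.prod η).withDensity (fun q : P × E => ENNReal.ofReal (Real.exp (-T q.1))) = νT.prod η := by
    rw [hνT, prod_withDensity_left hTm]
  have hZ' : (volP.prod η).withDensity (fun q : P × E => ENNReal.ofReal (Real.exp (-T q.1))) univ = νT univ := by
    rw [hνT', ← univ_prod_univ, Measure.prod_prod, show η univ = 1 from measure_univ, mul_one]
  have h := hmc_config_exact (vol := vol) (volP := volP.prod η) (hΦ := hΦ) (S := S)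
    (T := fun q : P × E => T q.1) hS hT' (jitterMap_involutive hinv) (measurePreserving_jitterMap hΦ hvol)
    (by rw [hZ']; exact hZ0) (by rw [hZ']; exact hZtop)
  beta_reduce at h
  rw [hZ', hνT', ← Measure.prod_smul_left] at h
  exact h

end Exact

/-! ## §4 Atoms of the jitter law: Doeblin powers pass to the jittered update -/

section Atom

variable {Φ : E → Ω × P → Ω × P} {hΦ : Measurable (jitterMap Φ)} {S : Ω → ℝ} {T : P → ℝ}
  {η : Measure E} {μP : Measure P}

/-- **THE JITTERED UPDATE DOMINATES EACH ATOM'S UPDATE**: `η{e₀} · K_{e₀}(u, ·) ≤ K_jit(u, ·)`. -/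
theorem smul_frozen_le_jitterHMC [SFinite η] [SFinite μP] [MeasurableSingletonClass E]
    (hS : Measurable S) (hT : Measurable T) (e₀ : E) (u : Ω) :
    η {e₀} • refreshUpdate (involMH (Φ e₀) (measurable_of_jitterMap hΦ e₀) fun z : Ω × P => S z.1 + T z.2) μP u
      ≤ jitterHMC Φ hΦ S T η μP u := by
  refine Measure.le_iff.2 fun A hA => ?_
  rw [Measure.smul_apply, smul_eq_mul, jitterHMC_apply Φ hΦ η μP hS hT u hA, mul_comm]
  calc _ = ∫⁻ e in {e₀}, refreshUpdate (involMH (Φ e) (measurable_of_jitterMap hΦ e)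
        fun z : Ω × P => S z.1 + T z.2) μP u A ∂η :=
      (lintegral_singleton (μ := η) (fun e => refreshUpdate (involMH (Φ e) (measurable_of_jitterMap hΦ e)
        fun z : Ω × P => S z.1 + T z.2) μP u A) e₀).symm
    _ ≤ _ := setLIntegral_le_lintegral _ _

/-- **A DOEBLIN POWER OF AN ATOM'S UPDATE PASSES TO THE JITTERED UPDATE**: if
`a · ν ≤ K_{e₀}^{k+1}(u, ·)` for every `u`, then `(η{e₀}^{k+1} a) · ν ≤ K_jit^{k+1}(u, ·)` for every `u`. -/
theorem jitterHMC_nHit_minorised_of_atom [SFinite η] [SFinite μP] [MeasurableSingletonClass E]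
    (hS : Measurable S) (hT : Measurable T) (e₀ : E) {ν : Measure Ω} {a : ℝ≥0∞} {k : ℕ}
    (h : ∀ u, a • ν ≤ nHit (refreshUpdate (involMH (Φ e₀) (measurable_of_jitterMap hΦ e₀)
      fun z : Ω × P => S z.1 + T z.2) μP) (k + 1) u) :
    ∀ u, (η {e₀} ^ (k + 1) * a) • ν ≤ nHit (jitterHMC Φ hΦ S T η μP) (k + 1) u := fun u =>
  calc (η {e₀} ^ (k + 1) * a) • ν = η {e₀} ^ (k + 1) • (a • ν) := by rw [smul_smul]
    _ ≤ η {e₀} ^ (k + 1) • nHit (refreshUpdate (involMH (Φ e₀) (measurable_of_jitterMap hΦ e₀)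
          fun z : Ω × P => S z.1 + T z.2) μP) (k + 1) u := by
        refine Measure.le_iff'.2 fun B => ?_
        simp only [Measure.smul_apply, smul_eq_mul]
        exact mul_le_mul' le_rfl (Measure.le_iff'.1 (h u) B)
    _ ≤ nHit (jitterHMC Φ hΦ S T η μP) (k + 1) u :=
        smul_nHit_le_nHit (smul_frozen_le_jitterHMC (hΦ := hΦ) hS hT e₀) (k + 1) u

/-- **THE JITTERED CHAIN CONVERGES FROM EVERY START WHEN ONE ATOM'S UPDATE HAS A DOEBLIN POWER.**
`η`, `μP` probability laws, `η{e₀} ≠ 0`, `a · ν ≤ K_{e₀}^{k+1}(u, ·)` for all `u` (`ν` a probability law,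
`a ≠ 0`), and `π` an invariant probability law of the jittered update (§3).  Then for some `δ ∈ (0, 1]`:
`|μ₀ K_jitᵗ(A) − π(A)| ≤ (1 − δ)^{⌊t/(k+1)⌋}` for EVERY initial law `μ₀`, every `t`, every `A`, and `π` is
the unique invariant probability law of `K_jit`. -/
theorem jitterHMC_uniformlyErgodic_of_atom [IsProbabilityMeasure η] [IsProbabilityMeasure μP]
    [MeasurableSingletonClass E] (hS : Measurable S) (hT : Measurable T) {π : Measure Ω}
    [IsProbabilityMeasure π] (hinv : Invariant (jitterHMC Φ hΦ S T η μP) π) {e₀ : E} (he₀ : η {e₀} ≠ 0)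
    {ν : Measure Ω} [IsProbabilityMeasure ν] {a : ℝ≥0∞} (ha : a ≠ 0) {k : ℕ}
    (h : ∀ u, a • ν ≤ nHit (refreshUpdate (involMH (Φ e₀) (measurable_of_jitterMap hΦ e₀)
      fun z : Ω × P => S z.1 + T z.2) μP) (k + 1) u) :
    ∃ δ : ℝ, 0 < δ ∧ δ ≤ 1 ∧
      (∀ (μ₀ : Measure Ω) [IsProbabilityMeasure μ₀] (t : ℕ) (A : Set Ω),
        |((fun m : Measure Ω => m.bind (jitterHMC Φ hΦ S T η μP))^[t] μ₀).real A - π.real A|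
          ≤ (1 - δ) ^ (t / (k + 1))) ∧
      ∀ (π' : Measure Ω) [IsProbabilityMeasure π'], Invariant (jitterHMC Φ hΦ S T η μP) π' → π' = π := by
  haveI := isMarkovKernel_jitterHMC Φ hΦ η μP hS hT
  have hmin := jitterHMC_nHit_minorised_of_atom (hΦ := hΦ) (η := η) (μP := μP) hS hT e₀ h
  have ha0 : η {e₀} ^ (k + 1) * a ≠ 0 := mul_ne_zero (pow_ne_zero _ he₀) ha
  haveI : IsMarkovKernel (nHit (jitterHMC Φ hΦ S T η μP) (k + 1)) := isMarkovKernel_nHit _ _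
  obtain ⟨x₀⟩ := nonempty_of_isProbabilityMeasure π
  have ha1 : η {e₀} ^ (k + 1) * a ≤ 1 := by
    have h1 := Measure.le_iff'.1 (hmin x₀) univ
    rwa [Measure.smul_apply, smul_eq_mul, measure_univ, measure_univ, mul_one] at h1
  have hatop : η {e₀} ^ (k + 1) * a ≠ ⊤ := ne_top_of_le_ne_top ENNReal.one_ne_top ha1
  refine ⟨(η {e₀} ^ (k + 1) * a).toReal, ENNReal.toReal_pos ha0 hatop,
    ENNReal.toReal_le_of_le_ofReal zero_le_one (by rwa [ENNReal.ofReal_one]),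
    fun μ₀ _ t A => uniformlyErgodic_of_nHit_minorised hmin hinv μ₀ t A, fun π' _ hπ' => ?_⟩
  exact invariant_unique_of_minorised (κ := nHit (jitterHMC Φ hΦ S T η μP) (k + 1)) hmin
    (pos_iff_ne_zero.2 ha0) (invariant_nHit hinv _) (invariant_nHit hπ' _)

end Atom

end Summit.Ventures.LatticeQCDFlow.Exactness
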